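import Mathlib
import Summits.NavierStokesRegularity.FluidComputer.AbcClassIISections

/-!
# GROUP-B END-TO-END ON THE MODEL, CLASS II — preparations: the tail constant beyond the shell cube
# and the non-vanishing border
(profile-cert-3 g7, cell `ns-blowup`, 2026-08-27)

HONEST FRAMING (human rulings D-0035/D-0074): nothing here is a claim about Navier–Stokes blow-up.
WHAT THIS IS NOT: not NS evidence. MODEL lane (Navier–Stokes linearised about the forced ABC flow
`abcFlow 1 1 1`, class II, in instab4's orbit-adapted basis `bfam` / real matrix `amat` of
`AbcClassIIDefs`); no certificate, number or census word moves. Two inputs of the GROUP-B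
instantiation `AbcClassIIEigenpair.isLinNSEigenvalue_near_of_nested_certificate` (next file):

(the section pairing hypothesis `hA` with `s = √2` on every finite index set is instab3's
`AbcClassIIOpenBracket.section_pairing_amat`, reused by name;)
* `tail_const_off_shell` — the tail constant: `MU2 ≤ x + (K+2)²/R − √2` gives
  `MU2 ≤ x + |O_i|²/R − √2` off the cube `K+1` (`AbcClassIISections.sq_osupNorm_le_onormSq`);
* `exists_border_ne_zero` — a left inverse of the bordered Galerkin matrix forces the border
  `ṽ_h` to be non-zero on the head (else `𝔅(0, 1) = 𝔅(0, 0)`).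

Mathlib + the file named; no new definitions. bears_on LADDER-NS N5 / Z4-a(1). [folklore].
-/

noncomputable section

open scoped BigOperators ComplexConjugate InnerProductSpace
open Finset

namespace Summit.NavierStokesRegularity.FluidComputer.AbcClassIIEigenpair

open Literature.Analysis.FunctionSpaces
open Summit.NavierStokesRegularity.FluidComputer.AbcClassII

/-- **The tail constant off the shell cube**: if `MU2 ≤ x + (K+2)²/R − √2` (`R > 0`) then for every
orbit index outside `cubeIdx (K+1)` (equivalently: outside `cubeIdx K` and outside the shell
`cubeIdx (K+1) ∖ cubeIdx K`), `MU2 ≤ x − (−|O_i|²/R) − √2`. -/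
theorem tail_const_off_shell {R : ℝ} (hR : 0 < R) (K : ℕ) {x MU2 : ℝ}
    (h : MU2 ≤ x + ((K : ℝ) + 2) ^ 2 / R - Real.sqrt 2) :
    ∀ i : Idx, i ∉ cubeIdx K → i ∉ cubeIdx (K + 1) \ cubeIdx K →
      MU2 ≤ x - (-(onormSq i.1 / R)) - Real.sqrt 2 := by
  intro i hiK hish
  have hi : i ∉ cubeIdx (K + 1) := fun h' => hish (Finset.mem_sdiff.mpr ⟨h', hiK⟩)
  rw [mem_cubeIdx, not_le] at hi
  have h2 : ((K : ℝ) + 2) ^ 2 ≤ onormSq i.1 := by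
    have h1 : ((K : ℝ) + 2) ≤ ((osupNorm i.1 : ℕ) : ℝ) := by exact_mod_cast hi
    exact (pow_le_pow_left₀ (by positivity) h1 2).trans (sq_osupNorm_le_onormSq i.1)
  have h3 : ((K : ℝ) + 2) ^ 2 / R ≤ onormSq i.1 / R := div_le_div_of_nonneg_right h2 hR.le
  linarith

/-- **The border does not vanish on the head**: a left inverse of the bordered Galerkin matrix
`𝔅(c, m) = ((dg_i c_i − Σ_{j∈K} a_ij c_j + m ṽ_i)_{i∈K}, Σ_{i∈K} conj(ṽ_i) c_i)` forces `ṽ_i ≠ 0` for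
some `i ∈ K` (otherwise `𝔅(0, 1) = 𝔅(0, 0)`). Generic in the diagonal `dg` and the matrix `a`. -/
theorem exists_border_ne_zero (K : Finset Idx) (dg : Idx → ℂ) (a : Idx → Idx → ℂ) (vt : Idx → ℂ)
    (Binv : ((↥K → ℂ) × ℂ) →ₗ[ℂ] ((↥K → ℂ) × ℂ))
    (hBinv : ∀ (c : ↥K → ℂ) (m : ℂ),
      Binv (fun i : ↥K => dg i * c i - ∑ j : ↥K, a i j * c j + m * vt i,
        ∑ i : ↥K, conj (vt i) * c i) = (c, m)) :
    ∃ i ∈ K, vt i ≠ 0 := by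
  by_contra hall
  push Not at hall
  have h1 := hBinv (fun _ => 0) 1
  have h2 := hBinv (fun _ => 0) 0
  have e : (fun i : ↥K => dg i * (0 : ℂ) - ∑ j : ↥K, a i j * (0 : ℂ) + (1 : ℂ) * vt i,
      ∑ i : ↥K, conj (vt i) * (0 : ℂ)) =
      (fun i : ↥K => dg i * (0 : ℂ) - ∑ j : ↥K, a i j * (0 : ℂ) + (0 : ℂ) * vt i,
      ∑ i : ↥K, conj (vt i) * (0 : ℂ)) := by
    refine Prod.ext (funext fun i => ?_) rfl
    simp [hall i i.2]
  have h3 := h1.symm.trans ((congrArg Binv e).trans h2)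
  simpa using congrArg Prod.snd h3

end Summit.NavierStokesRegularity.FluidComputer.AbcClassIIEigenpair

end
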